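import Literature.MathematicalPhysics.QuantumFieldTheory.Balaban1983to89.B9SectBL2GReadY
import Literature.MathematicalPhysics.QuantumFieldTheory.Balaban1983to89.B9SectBGReadCodedY

/-!
# `Balaban1983to89.B9SectBL2GReadCodedY` — THE `L²` BOND LETTERS OF NODE 00 ON r06's CARRIER: the `ℓ²` transport `FBondY × ι ↔ (κ × SiteY) × ι`, the signs
# of def-Y's difference letters, and ★★ the printed-orientation halves of the fields `readGL2` ∕ `writeGL2` of gen 14's `L2GFrame₆` at the letters
# `GbC`, `conj b (diffLetter (bT shiftY) (bU coordC) η⁻¹ k)` (pub-ymgap N06 row 13, G side, `L²` member — the `L²` twin of gen 13's `B9SectBGReadCodedY`)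

T. Bałaban, *Propagators for lattice gauge theories in a background field*, Commun. Math. Phys. **99** (1985) 389–434
[`Balaban1985BackgroundPropagators`, "B9"], Thm 3.1 (3.46) p. 398, Thm 3.3 p. 399, Thm 3.4 p. 400, (3.3) p. 390, (3.8) p. 392; [4] = T. Bałaban,
*Propagators and renormalization transformations for lattice gauge theories. II*, Commun. Math. Phys. **96** (1984) 223–250
[`Balaban1984PropagatorsII`], Prop. 2.6 (2.140)–(2.141) p. 247, (2.51) p. 232.

statement-level skeleton of published theorems with citation tags; proofs where landed; nothing here is a claim about the Yang–Mills mass gap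

WHY THIS FILE (seat dag-n06-c gen 14).  gen 14's `B9SectBL2GReadY` reads ∕ writes the (3.46) block of `KACU` as block-`ℓ²` majorants of `conj b` of def-Y's words
on the carrier `FBondY × ι`.  The frame `L2GFrame₆` speaks r06's letters on `(κ × SiteY) × ι`: `Gb = GbC`, `∇♯_k = conj b (diffLetter (bT shiftY) (bU coordC)
η⁻¹ k)`.  This file is the `ℓ²` twin of gen 13's sup transport: §1 the `ℓ²` reindexing (`hasL2Majorant_reindex`, `hasL2Majorant_neg_iff`,
`hasL2Majorant_smul_unit`), §2 the two carrier transports (`hasL2Majorant_conj_bondOpCoordsRY`, `hasL2Majorant_conj_of_bondOpCoordsRY`), §3 the SIGNS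
of def-Y's difference letters against r06's at the constant `|c_f| = η⁻¹` (`exists_sign_cdBₗ`, `exists_sign_cdsBₗ`: `bondOpCoordsRY ∇_{U,ν} = ±∇♯_{inl ν}`,
`bondOpCoordsRY ∇*_{U,ν} = ±∇♯_{inr ν}`), §4 ★★ `readGL2_GbC_printed` — the (3.46) block of `KACU` at a `G`-valued base gives the block-ℓ² majorants of
`GbC`, `∇♯_{inl ν}GbC`, `GbC∇♯_{inr ν}`, `∇♯_{inl ν}GbC∇♯_{inr μ}`, `∇♯_{inl ν}∇♯_{inl μ}GbC`, `GbC∇♯_{inr ν}∇♯_{inr μ}` (print's orientations) with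
`(c_L·B₀, δ)`, and ★★ `writeGL2_GbC` — those six at a coded product (letters at the base) with `(B, δ)` give the block with `(c_W·B, δ)`.  The other
orientations (print's remark p. 398 «we may always replace ∇_U by ∇*_U, and vice versa») are the successor file's cross conversions.

HONEST SCOPE.  Bookkeeping over NODE 00's DEFINED readings and gen 13's letters; no estimate of [B9] is proved or asserted.  COUNT-NEUTRAL; N06 NOT
discharged; nothing continuum ∕ OS ∕ mass-gap ∕ Clay.  Cell `pub-ymgap` (HUMAN RULING D-0062), Track A node N06 [B9], row 13, 2026-08-29.

RELATED IN THE TREE, NOT DUPLICATED (used by name): gen 13's `B9SectBGReadCodedY` (`bondReindexY`, `blkC_bondReindexY`, `conj_bondOpCoordsRY_apply`,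
`bondOpCoordsRY_mul`, `bondOpCoordsRY_cdBₗ`, `bondOpCoordsRY_cdsBₗ`, `diffLetter_abs_eq`, `eta_inv_eq_abs_cf`, `GbC_eq_conj_bondOpCoordsRY`), gen 14's
`B9SectBL2GReadY` (`readGL2Y_KACU`, `writeGL2Y_KACU`), `B9SectBL2DictionaryY.coordC_base_eq`, `B6RandomWalkL2`.
-/

noncomputable section

namespace Literature.MathematicalPhysics.QuantumFieldTheory.Balaban1983to89.B9SectBL2GReadCodedY

open B6Ineq2142KLevelV1 (β)
open B6GlobalChartV1 (blkV1)
open B6KLevelCensusIndexV1 (KIdx kGeo)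
open B6RandomWalk (blockPiece)
open B6RandomWalkL2 (l2n l2n_sq l2n_smul HasL2Majorant hasL2Majorant_mono)
open B9Thm34Ext (toB6)
open B9FromB6 (L2Block)
open B9GeoNormsKLevelV1 (geo9K)
open B9Eq352DivFormLetters (conj coordEquiv conj_apply conj_neg)
open B9Eq352GradLetters (diffLetter)
open B9Eq371GradLetters (bT bU)
open B9CoReadingCoords (cdBₗ cdsBₗ cdBₗ_apply cdsBₗ_apply)
open B9PinMembersKLevelV1 (MemberY geo9Y bg9Y)
open B9Eq360DeltaPrimeAY (AfldY)
open B9SectBGpFrameCodedY (codingYx)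
open B9SectBGpLettersY (GVal decY decY_base coordC blkC)
open B9SectBL2DictionaryY (coordC_base_eq)
open B9SectBCodedCarrier (CCfg)
open B9SectBCodedReadingsU (KACU)
open B9SectBGWordDeltaAY (bondOpCoordsRY bondOpCoordsRY_apply GbC)
open B9SectBGReadCodedY (bondReindexY blkC_bondReindexY conj_bondOpCoordsRY_apply bondOpCoordsRY_mul bondOpCoordsRY_cdBₗ bondOpCoordsRY_cdsBₗ
  diffLetter_abs_eq eta_inv_eq_abs_cf GbC_eq_conj_bondOpCoordsRY)
open B9SectBL2GReadY (readGL2Y_KACU writeGL2Y_KACU)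
open B9RWSumsReadsNbr (nbr)
open Node00 (SiteY BlkY FBondY IBondY CfgY BondOpY BondParY UboxY shiftY cdB cdsB GAY GpY SiteParY)

variable {d ℓ : ℕ} {hd : 1 ≤ d + 1} {hL : Odd (ℓ + 1) ∧ 1 < ℓ + 1} {b₀ b₁ : ℝ}
variable {𝔸 : Type} [NormedRing 𝔸] [NormedAlgebra ℂ 𝔸] [CompleteSpace 𝔸]
variable {ι : Type} [Fintype ι]

/-! ## §1 The `ℓ²` reindexing, signs and units -/

section Reindex

variable {g : B6.Geometry} {X X' : Type} [Fintype X] [Fintype X']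

/-- ★ a block-`ℓ²` majorant is transported along a reindexing `e : X ≃ X′` compatible with the block maps: if `T′ u′ x′ = T (u′ ∘ e) (e⁻¹ x′)` then
`HasL2Majorant blk T K → HasL2Majorant blk′ T′ K`. [cite: Balaban1984PropagatorsII, (2.51) p.232, (2.140) p.247, bookkeeping] -/
theorem hasL2Majorant_reindex (e : X ≃ X') {blk : X → g.Site} {blk' : X' → g.Site} (hblk : ∀ x, blk' (e x) = blk x)
    (T : Module.End ℝ (X → ℝ)) (T' : Module.End ℝ (X' → ℝ)) (hT : ∀ (u' : X' → ℝ) (x' : X'), T' u' x' = T (u' ∘ e) (e.symm x'))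
    {K : g.Site → g.Site → ℝ} (h : HasL2Majorant blk T K) : HasL2Majorant blk' T' K := by
  intro y y' u' hu'
  have hu : ∀ x, blk x ≠ y' → (u' ∘ e) x = 0 := fun x hx => hu' (e x) (by rw [hblk]; exact hx)
  have h1 := h y y' (u' ∘ e) hu
  have hsq : ∀ (v : X → ℝ), l2n (v ∘ e.symm) = l2n v := fun v => by
    have := l2n_sq (v ∘ e.symm)
    rw [show ∑ x', (v ∘ e.symm) x' ^ 2 = ∑ x, v x ^ 2 from Equiv.sum_comp e.symm (fun x => v x ^ 2), ← l2n_sq] at this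
    exact (pow_left_inj₀ (B6RandomWalkL2.l2n_nonneg _) (B6RandomWalkL2.l2n_nonneg _) two_ne_zero).1 this
  have hpiece : blockPiece blk' y (T' u') = (blockPiece blk y (T (u' ∘ e))) ∘ e.symm := by
    funext x'
    simp only [blockPiece, Function.comp_apply]
    rw [← hblk (e.symm x'), Equiv.apply_symm_apply, hT]
  have hn : l2n u' = l2n (u' ∘ e) := by
    have hu'e : u' = (u' ∘ e) ∘ e.symm := by funext x'; simp
    conv_lhs => rw [hu'e]
    exact hsq _
  rw [hpiece, hsq, hn]
  exact h1

omit [Fintype X'] in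
/-- a block-`ℓ²` majorant is blind to the sign of the operator. [cite: Balaban1984PropagatorsII, (2.51) p.232, bookkeeping] -/
theorem hasL2Majorant_neg_iff {blk : X → g.Site} (T : Module.End ℝ (X → ℝ)) {K : g.Site → g.Site → ℝ} :
    HasL2Majorant blk (-T) K ↔ HasL2Majorant blk T K := by
  have key : ∀ (y : g.Site) (u : X → ℝ), blockPiece blk y ((-T) u) = (-1 : ℝ) • blockPiece blk y (T u) := fun y u => by
    funext x; simp only [blockPiece, LinearMap.neg_apply, Pi.neg_apply, Pi.smul_apply, smul_eq_mul]; split_ifs <;> ring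
  constructor <;> intro h y y' u hu <;> have h1 := h y y' u hu
  · rw [key, l2n_smul, abs_neg, abs_one, one_mul] at h1; exact h1
  · rw [key, l2n_smul, abs_neg, abs_one, one_mul]; exact h1

omit [Fintype X'] in
/-- a block-`ℓ²` majorant is blind to a unit scalar factor. [cite: Balaban1984PropagatorsII, (2.51) p.232, bookkeeping] -/
theorem hasL2Majorant_smul_unit {blk : X → g.Site} (T : Module.End ℝ (X → ℝ)) {K : g.Site → g.Site → ℝ} {ε : ℝ} (hε : |ε| = 1)
    (h : HasL2Majorant blk (ε • T) K) : HasL2Majorant blk T K := by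
  intro y y' u hu
  have h1 := h y y' u hu
  have key : blockPiece blk y ((ε • T) u) = ε • blockPiece blk y (T u) := by
    funext x; simp only [blockPiece, LinearMap.smul_apply, Pi.smul_apply, smul_eq_mul]; split_ifs <;> ring
  rw [key, l2n_smul, hε, one_mul] at h1
  exact h1

omit [Fintype X'] in
/-- a block-`ℓ²` majorant is blind to a product of two unit scalar factors (either order is read off the hypothesis).
[cite: Balaban1984PropagatorsII, (2.51) p.232, bookkeeping] -/
theorem hasL2Majorant_smul_unit₂ {blk : X → g.Site} (T : Module.End ℝ (X → ℝ)) {K : g.Site → g.Site → ℝ} {ε ε' : ℝ} (hε : |ε| = 1)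
    (hε' : |ε'| = 1) (h : HasL2Majorant blk ((ε * ε') • T) K) : HasL2Majorant blk T K :=
  hasL2Majorant_smul_unit T (by rw [abs_mul, hε, hε', one_mul]) h

end Reindex

/-! ## §2 The two carrier transports -/

section Bond

variable (i : KIdx d ℓ hd hL b₀ b₁) (b : Module.Basis ι ℝ 𝔸) {Rr : ℝ} {Hp : Prop} [Fintype (geo9K i).Site] (ιB : BlkY i → IBondY i)

omit [CompleteSpace 𝔸] in
/-- ★ TRANSPORT, def-Y's carrier → r06's: a block-`ℓ²` majorant of `conj b T` on `FBondY × ι` IS one of `conj b (bondOpCoordsRY T)` on `(κ × SiteY) × ι`,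
same kernel. [cite: Balaban1984PropagatorsII, (2.51) p.232, (2.140) p.247, bookkeeping] -/
theorem hasL2Majorant_conj_bondOpCoordsRY (T : Module.End ℝ (FBondY i → 𝔸)) {K : IBondY i → IBondY i → ℝ}
    (h : HasL2Majorant (g := toB6 (geo9K i) Rr Hp) (fun p : FBondY i × ι => ιB (blkV1 i.hN i.D p.1)) (conj b T) K) :
    HasL2Majorant (g := toB6 (geo9K i) Rr Hp) (fun q : (Fin (d + 1) × SiteY i) × ι => blkC i ιB q.1.2) (conj b (bondOpCoordsRY i T)) K :=
  hasL2Majorant_reindex (bondReindexY (ι := ι) i) (fun p => blkC_bondReindexY (ι := ι) i ιB p) _ _ (conj_bondOpCoordsRY_apply i b T) h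

omit [CompleteSpace 𝔸] in
/-- ★ TRANSPORT, r06's carrier → def-Y's. [cite: Balaban1984PropagatorsII, (2.51) p.232, (2.140) p.247, bookkeeping] -/
theorem hasL2Majorant_conj_of_bondOpCoordsRY (T : Module.End ℝ (FBondY i → 𝔸)) {K : IBondY i → IBondY i → ℝ}
    (h : HasL2Majorant (g := toB6 (geo9K i) Rr Hp) (fun q : (Fin (d + 1) × SiteY i) × ι => blkC i ιB q.1.2) (conj b (bondOpCoordsRY i T)) K) :
    HasL2Majorant (g := toB6 (geo9K i) Rr Hp) (fun p : FBondY i × ι => ιB (blkV1 i.hN i.D p.1)) (conj b T) K := by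
  refine hasL2Majorant_reindex (bondReindexY (ι := ι) i).symm (blk := fun q : (Fin (d + 1) × SiteY i) × ι => blkC i ιB q.1.2) (fun q => ?_) _ _
    (fun μ p => ?_) h
  · rw [← blkC_bondReindexY (ι := ι) i ιB, Equiv.apply_symm_apply]
  · rw [conj_bondOpCoordsRY_apply, Equiv.symm_symm]
    simp only [Function.comp_def, Equiv.symm_apply_apply]

end Bond

/-! ## §3 The signs of def-Y's difference letters against r06's at the constant `|c_f|` -/

section Signs

variable (i : KIdx d ℓ hd hL b₀ b₁) (b : Module.Basis ι ℝ 𝔸)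

/-- ★ `conj b (bondOpCoordsRY ∇_{U,ν}) = ε·conj b (∇♯_{inl ν})` at the constant `|c_f|`, `ε = ±1`. [cite: Balaban1985BackgroundPropagators, (3.3) p.390, (3.42) p.397] -/
theorem exists_sign_cdBₗ (U : CfgY 𝔸 i) (ν : Fin (d + 1)) : ∃ ε : ℝ, |ε| = 1 ∧
    conj b (bondOpCoordsRY i (cdBₗ i U ν)) = ε • conj b (diffLetter (bT (shiftY i)) (bU (UboxY i U)) ((|i.cf| : ℝ) : ℂ) (Sum.inl ν)) := by
  rw [bondOpCoordsRY_cdBₗ]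
  rcases diffLetter_abs_eq (bT (shiftY i)) (bU (UboxY i U)) i.cf (Sum.inl ν) with h | h
  · exact ⟨1, by norm_num, by rw [h, one_smul]⟩
  · exact ⟨-1, by norm_num, by rw [h, conj_neg]; module⟩

/-- ★ `conj b (bondOpCoordsRY ∇*_{U,ν}) = ε·conj b (∇♯_{inr ν})` at the constant `|c_f|`, `ε = ±1`. [cite: Balaban1985BackgroundPropagators, (3.8) p.392, (3.42) p.397] -/
theorem exists_sign_cdsBₗ (U : CfgY 𝔸 i) (ν : Fin (d + 1)) : ∃ ε : ℝ, |ε| = 1 ∧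
    conj b (bondOpCoordsRY i (cdsBₗ i U ν)) = ε • conj b (diffLetter (bT (shiftY i)) (bU (UboxY i U)) ((|i.cf| : ℝ) : ℂ) (Sum.inr ν)) := by
  rw [bondOpCoordsRY_cdsBₗ, conj_neg]
  rcases diffLetter_abs_eq (bT (shiftY i)) (bU (UboxY i U)) i.cf (Sum.inr ν) with h | h
  · exact ⟨-1, by norm_num, by rw [h]; module⟩
  · exact ⟨1, by norm_num, by rw [h, conj_neg]; module⟩

omit [CompleteSpace 𝔸] [Fintype ι] in
/-- `|ε·ε′| = 1` for units. [cite: Balaban1984PropagatorsII, (2.51) p.232, bookkeeping] -/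
theorem abs_mul_eq_one {ε ε' : ℝ} (h : |ε| = 1) (h' : |ε'| = 1) : |ε * ε'| = 1 := by rw [abs_mul, h, h', one_mul]

end Signs

/-! ## §4 ★★ The printed-orientation halves of the fields `readGL2` ∕ `writeGL2` at the letters `GbC` -/

section Fields

variable {Mstar : ℕ} (G : Subgroup 𝔸ˣ) (x : MemberY d ℓ hd hL b₀ b₁ Mstar) (parS : SiteParY 𝔸 x.toKIdx) (parB : BondParY 𝔸 x.toKIdx)
  (b : Module.Basis ι ℝ 𝔸) (ιB : BlkY x.toKIdx → IBondY x.toKIdx) (C37 C38 : ℝ → CfgY 𝔸 x.toKIdx → AfldY 𝔸 x.toKIdx → Prop)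
  [Fintype (geo9Y x).Site] [DecidableEq (geo9Y x).Site] {Rr : ℝ} {Hp : Prop}

omit [CompleteSpace 𝔸] [Fintype ι] [DecidableEq (geo9Y x).Site] in
/-- a unit multiple of an operator with a block-`ℓ²` majorant has the majorant. [cite: Balaban1984PropagatorsII, (2.51) p.232, bookkeeping] -/
theorem hasL2Majorant_unit_smul {X : Type} [Fintype X] {blk : X → IBondY x.toKIdx} {T : Module.End ℝ (X → ℝ)}
    {K : IBondY x.toKIdx → IBondY x.toKIdx → ℝ} {ε : ℝ} (hε : |ε| = 1) (h : HasL2Majorant (g := toB6 (geo9Y x) Rr Hp) blk T K) :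
    HasL2Majorant (g := toB6 (geo9Y x) Rr Hp) blk (ε • T) K := by
  refine hasL2Majorant_smul_unit (ε := ε) _ hε ?_
  have hεε : ε * ε = 1 := by nlinarith [abs_mul_abs_self ε, sq_abs ε]
  rw [smul_smul, hεε, one_smul]; exact h

/-- ★★ **FIELD `readGL2` OF THE `L²` FRAME AT NODE 00's LETTERS, PRINT's ORIENTATIONS** (at a `G`-valued base `U`): the (3.46) block of
`KACU G x (GAY parS parB (GpY parS)) parB C37 C38` at `base U` with `(B₀, δ)` gives block-ℓ² majorants on `(κ × SiteY) × ι` with `(c_L·B₀, δ)`, `c_L =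
√|ι|·M₂·Σ_j‖b_j‖`, of `GbC` (weight `ℓ²`), `∇♯_{inl ν}·GbC`, `GbC·∇♯_{inr ν}` (weight `ℓ`), `∇♯_{inl ν}·GbC·∇♯_{inr μ}`, `∇♯_{inl ν}·∇♯_{inl μ}·GbC`,
`GbC·∇♯_{inr ν}·∇♯_{inr μ}` (weight `1`) — the six printed words; letters `∇♯_k = conj b (diffLetter (bT shiftY) (bU (coordC (base U))) η⁻¹ k)`.
[cite: Balaban1985BackgroundPropagators, Thm 3.3 p.399 with (3.46) p.398, Thm 3.4 p.400; Balaban1984PropagatorsII, Prop. 2.6 (2.140) p.247, (2.51) p.232] -/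
theorem readGL2_GbC_printed [FiniteDimensional ℝ 𝔸] (hι : ∀ s, β x.toKIdx.hN x.toKIdx.D x.toKIdx.hk (ιB s) = s)
    {M₂ : ℝ} (hM₂ : 0 ≤ M₂) (hrepr : ∀ (v : 𝔸) (j : ι), |b.repr v j| ≤ M₂ * ‖v‖) (U : CfgY 𝔸 x.toKIdx) (hUG : GVal G x.toKIdx U)
    {B₀ δ : ℝ} (hB₀ : 0 ≤ B₀) (hL2 : L2Block (KACU G x (GAY x.toKIdx parS parB (GpY x.toKIdx parS)) parB C37 C38) B₀ δ (.base U)) :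
    HasL2Majorant (g := toB6 (geo9Y x) Rr Hp) (fun q : (Fin (d + 1) × SiteY x.toKIdx) × ι => blkC x.toKIdx ιB q.1.2) (GbC x.toKIdx parS parB b (.base U)) (fun a a' => (Real.sqrt (Fintype.card ι) * M₂ * ∑ j, ‖b j‖) * B₀ * (geo9Y x).len a ^ 2 * Real.exp (-(δ * (geo9Y x).dist a a'))) ∧
      (∀ ν, HasL2Majorant (g := toB6 (geo9Y x) Rr Hp) (fun q : (Fin (d + 1) × SiteY x.toKIdx) × ι => blkC x.toKIdx ιB q.1.2)
        (conj b (diffLetter (bT (shiftY x.toKIdx)) (bU (coordC G x.toKIdx (.base U))) (((((geo9Y x).eta : ℂ)))⁻¹) (Sum.inl ν)) * GbC x.toKIdx parS parB b (.base U)) (fun a a' => (Real.sqrt (Fintype.card ι) * M₂ * ∑ j, ‖b j‖) * B₀ * (geo9Y x).len a * Real.exp (-(δ * (geo9Y x).dist a a')))) ∧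
      (∀ ν, HasL2Majorant (g := toB6 (geo9Y x) Rr Hp) (fun q : (Fin (d + 1) × SiteY x.toKIdx) × ι => blkC x.toKIdx ιB q.1.2)
        (GbC x.toKIdx parS parB b (.base U) * conj b (diffLetter (bT (shiftY x.toKIdx)) (bU (coordC G x.toKIdx (.base U))) (((((geo9Y x).eta : ℂ)))⁻¹) (Sum.inr ν))) (fun a a' => (Real.sqrt (Fintype.card ι) * M₂ * ∑ j, ‖b j‖) * B₀ * (geo9Y x).len a * Real.exp (-(δ * (geo9Y x).dist a a')))) ∧
      (∀ ν μ, HasL2Majorant (g := toB6 (geo9Y x) Rr Hp) (fun q : (Fin (d + 1) × SiteY x.toKIdx) × ι => blkC x.toKIdx ιB q.1.2)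
        (conj b (diffLetter (bT (shiftY x.toKIdx)) (bU (coordC G x.toKIdx (.base U))) (((((geo9Y x).eta : ℂ)))⁻¹) (Sum.inl ν)) * GbC x.toKIdx parS parB b (.base U) *
          conj b (diffLetter (bT (shiftY x.toKIdx)) (bU (coordC G x.toKIdx (.base U))) (((((geo9Y x).eta : ℂ)))⁻¹) (Sum.inr μ))) (fun a a' => (Real.sqrt (Fintype.card ι) * M₂ * ∑ j, ‖b j‖) * B₀ * 1 * Real.exp (-(δ * (geo9Y x).dist a a')))) ∧
      (∀ ν μ, HasL2Majorant (g := toB6 (geo9Y x) Rr Hp) (fun q : (Fin (d + 1) × SiteY x.toKIdx) × ι => blkC x.toKIdx ιB q.1.2)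
        (conj b (diffLetter (bT (shiftY x.toKIdx)) (bU (coordC G x.toKIdx (.base U))) (((((geo9Y x).eta : ℂ)))⁻¹) (Sum.inl ν)) *
          conj b (diffLetter (bT (shiftY x.toKIdx)) (bU (coordC G x.toKIdx (.base U))) (((((geo9Y x).eta : ℂ)))⁻¹) (Sum.inl μ)) * GbC x.toKIdx parS parB b (.base U)) (fun a a' => (Real.sqrt (Fintype.card ι) * M₂ * ∑ j, ‖b j‖) * B₀ * 1 * Real.exp (-(δ * (geo9Y x).dist a a')))) ∧
      (∀ ν μ, HasL2Majorant (g := toB6 (geo9Y x) Rr Hp) (fun q : (Fin (d + 1) × SiteY x.toKIdx) × ι => blkC x.toKIdx ιB q.1.2)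
        (GbC x.toKIdx parS parB b (.base U) * conj b (diffLetter (bT (shiftY x.toKIdx)) (bU (coordC G x.toKIdx (.base U))) (((((geo9Y x).eta : ℂ)))⁻¹) (Sum.inr ν)) *
          conj b (diffLetter (bT (shiftY x.toKIdx)) (bU (coordC G x.toKIdx (.base U))) (((((geo9Y x).eta : ℂ)))⁻¹) (Sum.inr μ))) (fun a a' => (Real.sqrt (Fintype.card ι) * M₂ * ∑ j, ‖b j‖) * B₀ * 1 * Real.exp (-(δ * (geo9Y x).dist a a')))) := by
  letI : Fintype (geo9K x.toKIdx).Site := ‹Fintype (geo9Y x).Site›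
  letI : DecidableEq (geo9K x.toKIdx).Site := ‹DecidableEq (geo9Y x).Site›
  obtain ⟨h0, h1, h2, h3, h4, h5⟩ := readGL2Y_KACU (Rr := Rr) (Hp := Hp) b G x (GAY x.toKIdx parS parB (GpY x.toKIdx parS)) parB C37 C38 ιB hι hM₂ hrepr
    hB₀ hL2
  have hco : coordC G x.toKIdx (.base U) = UboxY x.toKIdx U := coordC_base_eq G x hUG
  have hη : (((((geo9Y x).eta : ℂ))))⁻¹ = ((|x.toKIdx.cf| : ℝ) : ℂ) := eta_inv_eq_abs_cf x.toKIdx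
  have hGb : GbC x.toKIdx parS parB b (.base U) = conj b (bondOpCoordsRY x.toKIdx ((GAY x.toKIdx parS parB (GpY x.toKIdx parS) U).restrictScalars ℝ)) := by
    have h := GbC_eq_conj_bondOpCoordsRY x parS parB b (.base U)
    rw [decY_base] at h
    exact h
  -- def-Y's difference letters against the frame's, with their signs
  have hDl : ∀ ν, ∃ ε : ℝ, |ε| = 1 ∧ conj b (bondOpCoordsRY x.toKIdx (cdBₗ x.toKIdx U ν)) =
      ε • conj b (diffLetter (bT (shiftY x.toKIdx)) (bU (coordC G x.toKIdx (.base U))) (((((geo9Y x).eta : ℂ)))⁻¹) (Sum.inl ν)) := fun ν => by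
    rw [hco, hη]; exact exists_sign_cdBₗ x.toKIdx b U ν
  have hDr : ∀ ν, ∃ ε : ℝ, |ε| = 1 ∧ conj b (bondOpCoordsRY x.toKIdx (cdsBₗ x.toKIdx U ν)) =
      ε • conj b (diffLetter (bT (shiftY x.toKIdx)) (bU (coordC G x.toKIdx (.base U))) (((((geo9Y x).eta : ℂ)))⁻¹) (Sum.inr ν)) := fun ν => by
    rw [hco, hη]; exact exists_sign_cdsBₗ x.toKIdx b U ν
  -- reshaping of the kernels `cL * (B₀ * pref6 n * e)` into the frame's `cL * B₀ * w * e`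
  have hK : ∀ (w : IBondY x.toKIdx → ℝ) (n : Fin 6), (∀ a, B9.pref6 ((geo9Y x).len a) n = w a) →
      ∀ {T : Module.End ℝ ((Fin (d + 1) × SiteY x.toKIdx) × ι → ℝ)} {K : IBondY x.toKIdx → IBondY x.toKIdx → ℝ},
      (∀ a a', K a a' = (Real.sqrt (Fintype.card ι) * M₂ * ∑ j, ‖b j‖) *
        (B₀ * B9.pref6 ((geo9K x.toKIdx).len a) n * Real.exp (-(δ * (geo9K x.toKIdx).dist a a')))) →
      HasL2Majorant (g := toB6 (geo9Y x) Rr Hp) (fun q : (Fin (d + 1) × SiteY x.toKIdx) × ι => blkC x.toKIdx ιB q.1.2) T K →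
      HasL2Majorant (g := toB6 (geo9Y x) Rr Hp) (fun q : (Fin (d + 1) × SiteY x.toKIdx) × ι => blkC x.toKIdx ιB q.1.2) T
        (fun a a' => (Real.sqrt (Fintype.card ι) * M₂ * ∑ j, ‖b j‖) * B₀ * w a * Real.exp (-(δ * (geo9Y x).dist a a'))) := by
    intro w n hw T K hKe h
    refine hasL2Majorant_mono (g := toB6 (geo9Y x) Rr Hp) _ h fun a a' => le_of_eq ?_
    rw [hKe, ← hw a]
    show _ = (Real.sqrt (Fintype.card ι) * M₂ * ∑ j, ‖b j‖) * B₀ * B9.pref6 ((geo9K x.toKIdx).len a) n *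
      Real.exp (-(δ * (geo9K x.toKIdx).dist a a'))
    ring
  refine ⟨?_, fun ν => ?_, fun ν => ?_, fun ν μ => ?_, fun ν μ => ?_, fun ν μ => ?_⟩
  · rw [hGb]
    exact hK (fun a => (geo9Y x).len a ^ 2) 0 (fun a => rfl) (fun a a' => rfl) (hasL2Majorant_conj_bondOpCoordsRY x.toKIdx b ιB _ h0)
  · obtain ⟨ε, hε, hD⟩ := hDl ν
    have h := hasL2Majorant_conj_bondOpCoordsRY x.toKIdx b ιB _ (h1 ν)
    rw [← Module.End.mul_eq_comp, bondOpCoordsRY_mul, B9Eq352DivFormLetters.conj_mul, hD, ← hGb] at h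
    simp only [smul_mul_assoc] at h
    exact hK (fun a => (geo9Y x).len a) 1 (fun a => rfl) (fun a a' => rfl) (hasL2Majorant_smul_unit _ hε h)
  · obtain ⟨ε, hε, hD⟩ := hDr ν
    have h := hasL2Majorant_conj_bondOpCoordsRY x.toKIdx b ιB _ (h2 ν)
    rw [← Module.End.mul_eq_comp, bondOpCoordsRY_mul, B9Eq352DivFormLetters.conj_mul, hD, ← hGb] at h
    simp only [mul_smul_comm] at h
    exact hK (fun a => (geo9Y x).len a) 2 (fun a => rfl) (fun a a' => rfl) (hasL2Majorant_smul_unit _ hε h)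
  · obtain ⟨ε, hε, hD⟩ := hDl ν
    obtain ⟨ε', hε', hD'⟩ := hDr μ
    have h := hasL2Majorant_conj_bondOpCoordsRY x.toKIdx b ιB _ (h3 ν μ)
    rw [← Module.End.mul_eq_comp, ← Module.End.mul_eq_comp, bondOpCoordsRY_mul, bondOpCoordsRY_mul, B9Eq352DivFormLetters.conj_mul,
      B9Eq352DivFormLetters.conj_mul, hD, hD', ← hGb] at h
    simp only [smul_mul_assoc, mul_smul_comm, smul_smul, ← mul_assoc] at h
    exact hK (fun _ => (1 : ℝ)) 3 (fun a => rfl) (fun a a' => by ring) (hasL2Majorant_smul_unit₂ _ (by assumption) (by assumption) h)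
  · obtain ⟨ε, hε, hD⟩ := hDl ν
    obtain ⟨ε', hε', hD'⟩ := hDl μ
    have h := hasL2Majorant_conj_bondOpCoordsRY x.toKIdx b ιB _ (h4 ν μ)
    rw [← Module.End.mul_eq_comp, ← Module.End.mul_eq_comp, bondOpCoordsRY_mul, bondOpCoordsRY_mul, B9Eq352DivFormLetters.conj_mul,
      B9Eq352DivFormLetters.conj_mul, hD, hD', ← hGb] at h
    simp only [smul_mul_assoc, mul_smul_comm, smul_smul, ← mul_assoc] at h
    exact hK (fun _ => (1 : ℝ)) 4 (fun a => rfl) (fun a a' => by ring) (hasL2Majorant_smul_unit₂ _ (by assumption) (by assumption) h)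
  · obtain ⟨ε, hε, hD⟩ := hDr ν
    obtain ⟨ε', hε', hD'⟩ := hDr μ
    have h := hasL2Majorant_conj_bondOpCoordsRY x.toKIdx b ιB _ (h5 ν μ)
    rw [← Module.End.mul_eq_comp, ← Module.End.mul_eq_comp, bondOpCoordsRY_mul, bondOpCoordsRY_mul, B9Eq352DivFormLetters.conj_mul,
      B9Eq352DivFormLetters.conj_mul, hD, hD', ← hGb] at h
    simp only [smul_mul_assoc, mul_smul_comm, smul_smul, ← mul_assoc] at h
    exact hK (fun _ => (1 : ℝ)) 5 (fun a => rfl) (fun a a' => by ring) (hasL2Majorant_smul_unit₂ _ (by assumption) (by assumption) h)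

/-- ★★ **FIELD `writeGL2` OF THE `L²` FRAME AT NODE 00's LETTERS, PRINT's ORIENTATIONS**: at a (base `U`, multiplier `a`) pair with `U` `G`-valued, block-ℓ²
majorants at the coded product (`GbC (prod U a)`; difference letters `∇♯_k` at the BASE) with `(B, δ)` of the six printed words give the (3.46) block of
`KACU` at `prod U a` with `(c_W·B, δ)`, `c_W = m_N·c_L·L²·e^{δ}` (gen 14's writer `writeGL2Y_KACU` transported).
[cite: Balaban1985BackgroundPropagators, Thm 3.4 p.400 with (3.46) p.398, p.403; Balaban1984PropagatorsII, Prop. 2.6 (2.140) p.247, (2.51) p.232] -/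
theorem writeGL2_GbC (hι : ∀ s, β x.toKIdx.hN x.toKIdx.D x.toKIdx.hk (ιB s) = s)
    {M₂ : ℝ} (hM₂ : 0 ≤ M₂) (hrepr : ∀ (v : 𝔸) (j : ι), |b.repr v j| ≤ M₂ * ‖v‖)
    {mN : ℕ} (hnbr : ∀ y : IBondY x.toKIdx, (nbr (geo9Y x) 1 y).card ≤ mN)
    (U : CfgY 𝔸 x.toKIdx) (hUG : GVal G x.toKIdx U) (a : AfldY 𝔸 x.toKIdx) {B δ : ℝ} (hB : 0 ≤ B) (hδ : 0 ≤ δ)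
    (h0 : HasL2Majorant (g := toB6 (geo9Y x) Rr Hp) (fun q : (Fin (d + 1) × SiteY x.toKIdx) × ι => blkC x.toKIdx ιB q.1.2) (GbC x.toKIdx parS parB b (.prod U a)) (fun a a' => B * (geo9Y x).len a ^ 2 * Real.exp (-(δ * (geo9Y x).dist a a'))))
    (h1 : ∀ ν, HasL2Majorant (g := toB6 (geo9Y x) Rr Hp) (fun q : (Fin (d + 1) × SiteY x.toKIdx) × ι => blkC x.toKIdx ιB q.1.2)
        (conj b (diffLetter (bT (shiftY x.toKIdx)) (bU (coordC G x.toKIdx (.base U))) (((((geo9Y x).eta : ℂ)))⁻¹) (Sum.inl ν)) * GbC x.toKIdx parS parB b (.prod U a)) (fun a a' => B * (geo9Y x).len a * Real.exp (-(δ * (geo9Y x).dist a a'))))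
    (h2 : ∀ ν, HasL2Majorant (g := toB6 (geo9Y x) Rr Hp) (fun q : (Fin (d + 1) × SiteY x.toKIdx) × ι => blkC x.toKIdx ιB q.1.2)
        (GbC x.toKIdx parS parB b (.prod U a) * conj b (diffLetter (bT (shiftY x.toKIdx)) (bU (coordC G x.toKIdx (.base U))) (((((geo9Y x).eta : ℂ)))⁻¹) (Sum.inr ν))) (fun a a' => B * (geo9Y x).len a * Real.exp (-(δ * (geo9Y x).dist a a'))))
    (h3 : ∀ ν μ, HasL2Majorant (g := toB6 (geo9Y x) Rr Hp) (fun q : (Fin (d + 1) × SiteY x.toKIdx) × ι => blkC x.toKIdx ιB q.1.2)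
        (conj b (diffLetter (bT (shiftY x.toKIdx)) (bU (coordC G x.toKIdx (.base U))) (((((geo9Y x).eta : ℂ)))⁻¹) (Sum.inl ν)) * GbC x.toKIdx parS parB b (.prod U a) *
          conj b (diffLetter (bT (shiftY x.toKIdx)) (bU (coordC G x.toKIdx (.base U))) (((((geo9Y x).eta : ℂ)))⁻¹) (Sum.inr μ))) (fun a a' => B * 1 * Real.exp (-(δ * (geo9Y x).dist a a'))))
    (h4 : ∀ ν μ, HasL2Majorant (g := toB6 (geo9Y x) Rr Hp) (fun q : (Fin (d + 1) × SiteY x.toKIdx) × ι => blkC x.toKIdx ιB q.1.2)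
        (conj b (diffLetter (bT (shiftY x.toKIdx)) (bU (coordC G x.toKIdx (.base U))) (((((geo9Y x).eta : ℂ)))⁻¹) (Sum.inl ν)) *
          conj b (diffLetter (bT (shiftY x.toKIdx)) (bU (coordC G x.toKIdx (.base U))) (((((geo9Y x).eta : ℂ)))⁻¹) (Sum.inl μ)) * GbC x.toKIdx parS parB b (.prod U a)) (fun a a' => B * 1 * Real.exp (-(δ * (geo9Y x).dist a a'))))
    (h5 : ∀ ν μ, HasL2Majorant (g := toB6 (geo9Y x) Rr Hp) (fun q : (Fin (d + 1) × SiteY x.toKIdx) × ι => blkC x.toKIdx ιB q.1.2)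
        (GbC x.toKIdx parS parB b (.prod U a) * conj b (diffLetter (bT (shiftY x.toKIdx)) (bU (coordC G x.toKIdx (.base U))) (((((geo9Y x).eta : ℂ)))⁻¹) (Sum.inr ν)) *
          conj b (diffLetter (bT (shiftY x.toKIdx)) (bU (coordC G x.toKIdx (.base U))) (((((geo9Y x).eta : ℂ)))⁻¹) (Sum.inr μ))) (fun a a' => B * 1 * Real.exp (-(δ * (geo9Y x).dist a a')))) :
    L2Block (KACU G x (GAY x.toKIdx parS parB (GpY x.toKIdx parS)) parB C37 C38)
      ((mN : ℝ) * (Real.sqrt (Fintype.card ι) * M₂ * ∑ j, ‖b j‖) * (((ℓ + 1 : ℕ) : ℝ)) ^ 2 * Real.exp δ * B) δ (.prod U a) := by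
  letI : Fintype (geo9K x.toKIdx).Site := ‹Fintype (geo9Y x).Site›
  letI : DecidableEq (geo9K x.toKIdx).Site := ‹DecidableEq (geo9Y x).Site›
  have hco : coordC G x.toKIdx (.base U) = UboxY x.toKIdx U := coordC_base_eq G x hUG
  have hη : (((((geo9Y x).eta : ℂ))))⁻¹ = ((|x.toKIdx.cf| : ℝ) : ℂ) := eta_inv_eq_abs_cf x.toKIdx
  set W := decY x.toKIdx (.prod U a) with hW
  set O := (GAY x.toKIdx parS parB (GpY x.toKIdx parS) W).restrictScalars ℝ with hO
  have hGb : GbC x.toKIdx parS parB b (.prod U a) = conj b (bondOpCoordsRY x.toKIdx O) := GbC_eq_conj_bondOpCoordsRY x parS parB b (.prod U a)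
  -- the frame's letters ARE unit multiples of def-Y's transported ones
  have hDl : ∀ ν, ∃ ε : ℝ, |ε| = 1 ∧ conj b (diffLetter (bT (shiftY x.toKIdx)) (bU (coordC G x.toKIdx (.base U))) (((((geo9Y x).eta : ℂ)))⁻¹) (Sum.inl ν)) =
      ε • conj b (bondOpCoordsRY x.toKIdx (cdBₗ x.toKIdx U ν)) := fun ν => by
    obtain ⟨ε, hε, h⟩ := exists_sign_cdBₗ x.toKIdx b U ν
    have hεε : ε * ε = 1 := by nlinarith [abs_mul_abs_self ε, sq_abs ε]
    refine ⟨ε, hε, ?_⟩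
    rw [hco, hη, h, smul_smul, hεε, one_smul]
  have hDr : ∀ ν, ∃ ε : ℝ, |ε| = 1 ∧ conj b (diffLetter (bT (shiftY x.toKIdx)) (bU (coordC G x.toKIdx (.base U))) (((((geo9Y x).eta : ℂ)))⁻¹) (Sum.inr ν)) =
      ε • conj b (bondOpCoordsRY x.toKIdx (cdsBₗ x.toKIdx U ν)) := fun ν => by
    obtain ⟨ε, hε, h⟩ := exists_sign_cdsBₗ x.toKIdx b U ν
    have hεε : ε * ε = 1 := by nlinarith [abs_mul_abs_self ε, sq_abs ε]
    refine ⟨ε, hε, ?_⟩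
    rw [hco, hη, h, smul_smul, hεε, one_smul]
  -- back to def-Y's carrier, word by word
  have back : ∀ {T : Module.End ℝ (FBondY x.toKIdx → 𝔸)} {K : IBondY x.toKIdx → IBondY x.toKIdx → ℝ} {ε : ℝ}, |ε| = 1 →
      HasL2Majorant (g := toB6 (geo9Y x) Rr Hp) (fun q : (Fin (d + 1) × SiteY x.toKIdx) × ι => blkC x.toKIdx ιB q.1.2) (ε • conj b (bondOpCoordsRY x.toKIdx T)) K →
      HasL2Majorant (g := toB6 (geo9K x.toKIdx) Rr Hp) (fun p : FBondY x.toKIdx × ι => ιB (blkV1 x.toKIdx.hN x.toKIdx.D p.1)) (conj b T) K :=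
    fun {T K ε} hε h => hasL2Majorant_conj_of_bondOpCoordsRY x.toKIdx b ιB _ (hasL2Majorant_smul_unit _ hε h)
  have back₂ : ∀ {T : Module.End ℝ (FBondY x.toKIdx → 𝔸)} {K : IBondY x.toKIdx → IBondY x.toKIdx → ℝ} {ε ε' : ℝ}, |ε| = 1 → |ε'| = 1 →
      HasL2Majorant (g := toB6 (geo9Y x) Rr Hp) (fun q : (Fin (d + 1) × SiteY x.toKIdx) × ι => blkC x.toKIdx ιB q.1.2)
        ((ε * ε') • conj b (bondOpCoordsRY x.toKIdx T)) K →
      HasL2Majorant (g := toB6 (geo9K x.toKIdx) Rr Hp) (fun p : FBondY x.toKIdx × ι => ιB (blkV1 x.toKIdx.hN x.toKIdx.D p.1)) (conj b T) K :=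
    fun {T K ε ε'} hε hε' h => hasL2Majorant_conj_of_bondOpCoordsRY x.toKIdx b ιB _ (hasL2Majorant_smul_unit₂ _ hε hε' h)
  have g0 : HasL2Majorant (g := toB6 (geo9K x.toKIdx) Rr Hp) (fun p : FBondY x.toKIdx × ι => ιB (blkV1 x.toKIdx.hN x.toKIdx.D p.1)) (conj b O)
      (fun a a' => B * (geo9K x.toKIdx).len a ^ 2 * Real.exp (-(δ * (geo9K x.toKIdx).dist a a'))) :=
    hasL2Majorant_conj_of_bondOpCoordsRY x.toKIdx b ιB _ (by rw [← hGb]; exact h0)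
  have g1 : ∀ ν, HasL2Majorant (g := toB6 (geo9K x.toKIdx) Rr Hp) (fun p : FBondY x.toKIdx × ι => ιB (blkV1 x.toKIdx.hN x.toKIdx.D p.1))
      (conj b (cdBₗ x.toKIdx U ν) * conj b O) (fun a a' => B * (geo9K x.toKIdx).len a * Real.exp (-(δ * (geo9K x.toKIdx).dist a a'))) := by
    intro ν
    obtain ⟨ε, hε, hD⟩ := hDl ν
    have h := h1 ν
    rw [hD, hGb] at h
    simp only [smul_mul_assoc, ← B9Eq352DivFormLetters.conj_mul, ← bondOpCoordsRY_mul] at h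
    have h' := back hε h
    rw [B9Eq352DivFormLetters.conj_mul] at h'
    exact h'
  have g2 : ∀ ν, HasL2Majorant (g := toB6 (geo9K x.toKIdx) Rr Hp) (fun p : FBondY x.toKIdx × ι => ιB (blkV1 x.toKIdx.hN x.toKIdx.D p.1))
      (conj b O * conj b (cdsBₗ x.toKIdx U ν)) (fun a a' => B * (geo9K x.toKIdx).len a * Real.exp (-(δ * (geo9K x.toKIdx).dist a a'))) := by
    intro ν
    obtain ⟨ε, hε, hD⟩ := hDr ν
    have h := h2 ν
    rw [hD, hGb] at h
    simp only [mul_smul_comm, ← B9Eq352DivFormLetters.conj_mul, ← bondOpCoordsRY_mul] at h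
    have h' := back hε h
    rw [B9Eq352DivFormLetters.conj_mul] at h'
    exact h'
  have g3 : ∀ ν μ, HasL2Majorant (g := toB6 (geo9K x.toKIdx) Rr Hp) (fun p : FBondY x.toKIdx × ι => ιB (blkV1 x.toKIdx.hN x.toKIdx.D p.1))
      (conj b (cdBₗ x.toKIdx U ν) * conj b O * conj b (cdsBₗ x.toKIdx U μ)) (fun a a' => B * 1 * Real.exp (-(δ * (geo9K x.toKIdx).dist a a'))) := by
    intro ν μ
    obtain ⟨ε, hε, hD⟩ := hDl ν
    obtain ⟨ε', hε', hD'⟩ := hDr μ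
    have h := h3 ν μ
    rw [hD, hD', hGb] at h
    simp only [smul_mul_assoc, mul_smul_comm, smul_smul, ← B9Eq352DivFormLetters.conj_mul, ← bondOpCoordsRY_mul] at h
    have h' : HasL2Majorant (g := toB6 (geo9K x.toKIdx) Rr Hp) (fun p : FBondY x.toKIdx × ι => ιB (blkV1 x.toKIdx.hN x.toKIdx.D p.1))
        (conj b (cdBₗ x.toKIdx U ν * O * cdsBₗ x.toKIdx U μ)) (fun a a' => B * 1 * Real.exp (-(δ * (geo9K x.toKIdx).dist a a'))) := by
      exact back₂ (by assumption) (by assumption) h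
    rw [B9Eq352DivFormLetters.conj_mul, B9Eq352DivFormLetters.conj_mul] at h'
    exact h'
  have g4 : ∀ ν μ, HasL2Majorant (g := toB6 (geo9K x.toKIdx) Rr Hp) (fun p : FBondY x.toKIdx × ι => ιB (blkV1 x.toKIdx.hN x.toKIdx.D p.1))
      (conj b (cdBₗ x.toKIdx U ν) * conj b (cdBₗ x.toKIdx U μ) * conj b O) (fun a a' => B * 1 * Real.exp (-(δ * (geo9K x.toKIdx).dist a a'))) := by
    intro ν μ
    obtain ⟨ε, hε, hD⟩ := hDl ν
    obtain ⟨ε', hε', hD'⟩ := hDl μ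
    have h := h4 ν μ
    rw [hD, hD', hGb] at h
    simp only [smul_mul_assoc, mul_smul_comm, smul_smul, ← B9Eq352DivFormLetters.conj_mul, ← bondOpCoordsRY_mul] at h
    have h' : HasL2Majorant (g := toB6 (geo9K x.toKIdx) Rr Hp) (fun p : FBondY x.toKIdx × ι => ιB (blkV1 x.toKIdx.hN x.toKIdx.D p.1))
        (conj b (cdBₗ x.toKIdx U ν * cdBₗ x.toKIdx U μ * O)) (fun a a' => B * 1 * Real.exp (-(δ * (geo9K x.toKIdx).dist a a'))) := by
      exact back₂ (by assumption) (by assumption) h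
    rw [B9Eq352DivFormLetters.conj_mul, B9Eq352DivFormLetters.conj_mul] at h'
    exact h'
  have g5 : ∀ ν μ, HasL2Majorant (g := toB6 (geo9K x.toKIdx) Rr Hp) (fun p : FBondY x.toKIdx × ι => ιB (blkV1 x.toKIdx.hN x.toKIdx.D p.1))
      (conj b O * conj b (cdsBₗ x.toKIdx U ν) * conj b (cdsBₗ x.toKIdx U μ)) (fun a a' => B * 1 * Real.exp (-(δ * (geo9K x.toKIdx).dist a a'))) := by
    intro ν μ
    obtain ⟨ε, hε, hD⟩ := hDr ν
    obtain ⟨ε', hε', hD'⟩ := hDr μ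
    have h := h5 ν μ
    rw [hD, hD', hGb] at h
    simp only [smul_mul_assoc, mul_smul_comm, smul_smul, ← B9Eq352DivFormLetters.conj_mul, ← bondOpCoordsRY_mul] at h
    have h' : HasL2Majorant (g := toB6 (geo9K x.toKIdx) Rr Hp) (fun p : FBondY x.toKIdx × ι => ιB (blkV1 x.toKIdx.hN x.toKIdx.D p.1))
        (conj b (O * cdsBₗ x.toKIdx U ν * cdsBₗ x.toKIdx U μ)) (fun a a' => B * 1 * Real.exp (-(δ * (geo9K x.toKIdx).dist a a'))) := by
      exact back₂ (by assumption) (by assumption) h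
    rw [B9Eq352DivFormLetters.conj_mul, B9Eq352DivFormLetters.conj_mul] at h'
    exact h'
  exact writeGL2Y_KACU (Rr := Rr) (Hp := Hp) b G x (GAY x.toKIdx parS parB (GpY x.toKIdx parS)) parB C37 C38 ιB hι hM₂ hrepr hnbr U a
    O (fun Λ => rfl) (fun ν => cdBₗ x.toKIdx U ν) (fun ν => cdsBₗ x.toKIdx U ν) (fun ν Λ => cdBₗ_apply x.toKIdx U ν Λ)
    (fun ν Λ => cdsBₗ_apply x.toKIdx U ν Λ) hB hδ g0 g1 g2 g3 g4 g5

end Fields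

end Literature.MathematicalPhysics.QuantumFieldTheory.Balaban1983to89.B9SectBL2GReadCodedY

end
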